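/-
Copyright (c) 2026 the pub-hodgecm-mathlib formalisation cell (harness21).  Prover seat hodgecm-mathlib-K2E4-p14 (g13) (VALVE 26 (ff) → S8), Track B ∕ K2-LIT, h413 = `stmt-HodgeConjecture-24833`,
R90-TF section S8 «ContSpec-n½», #4′ road, deal S8-R248 (6) (S8 dealer R90-CS-plan (g3); K2E3-p27 (g4)'s letter ledger 5c173261db2228a3 row (N_blk); census R90 bus 2026-09-05T03:20:22Z «=»):
the (N_blk) clause for the SELF-DUAL blocks at the top row, from the RUNG-1 self-dual package of K2E4-p23 — the self-dual twin of ★ `R90S8ResHOffDualNoLineMassU2` (K2E1-p12 (g5)).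
-/
import Summits.HodgeConjecture.HodgeConjecture.Theorems.R90S8ResHOffDualNoLineMassU2            -- ★ (K2E1-p12 g5): the OFF-DUAL twin (template) — brings ★ D5′ letter-free, ★ projector algebra, ★ `m1_level_witness`, ★ `hVc_maximalLevel_one`, ★ H4″ DEFS `resHBlock∕resHAtom∕resHLine`
import Summits.HodgeConjecture.HodgeConjecture.Theorems.K2E1ResidualBlockPackageSelfDualM1CMTwo   -- ★ RUNG-1 SD M1 (K2E4-p23 g3): `selfDual_block_package` (the self-dual per-block package: model `V`, residue-operator-form intertwining `hU`, `hline`, `hV`)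
import Literature.NumberTheory.Automorphic.AsaiAtOneRankOne                                     -- ★ (U) `HeckeCharacter.isUnitary_of_map_posRealIdele` (ray-trivial ⇒ unitary)
import HarnessLib

/-!
# S8 #4′ road, letter (N_blk) for the SELF-DUAL blocks — `R90S8ResHSelfDualBlockIntertwiningU2`: at the top row `(K_max, ω = 1)` an irreducible closed summand of `L²(U(J₂)_{L∕L⁺})`
# is ORTHOGONAL TO THE LINE SPACE of every self-dual block, in the RUNG-1 model whose Hecke intertwining is the residue-operator form `hSD` (K2E4-p23)

Track B ∕ R90-TF, crux h413 = `stmt-HodgeConjecture-24833`, route of record `HCCMUnconditional`; cell `hodgecm-mathlib`, section S8 «ContSpec-n½», socket #4′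
`sock_S8_resH_spannedByCharLines` of `Lines/R90_S8_ResidualSpectrumU3B.lean`.  THEOREMS ONLY (no `def`, no `instance`, no `notation`, no named-fact hypothesis, no `sorry`); ★-only
imports; lane `--supports stmt-HodgeConjecture-24833 --as helper` (count-neutral).  CLOSES NO SOCKET: it pays the (N_blk) binder `hN` of ★ p862113 (H7) for the SELF-DUAL blocks at the
TOP ROW `(K_max, 1)` in the rung-1 model; #4′ stays OPEN (the total family `U` below `K_max` ∕ at `ω ≠ 1`, hW1_wild, STR untouched).

THE MATHEMATICS ([MoeglinWaldspurger1995, II.2.4, IV.1.10, IV.3.12, V.3.13, VI.2]; [ReedSimonI1980, Thm. II.3]).  Fix a SELF-DUAL ray-trivial unitary Hecke character `χ` of `L`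
(`χʷ = χ`) with `V(χ, K, 1) ≠ ⊥`, `K = K_∞·GL₂(𝒪̂_L)`, and the `(K, 1)`-block `Sc = resHBlock K 1 χ` (closed span of the wave packets `[θ_{f,φ}]`).  RUNG 1 (★ K2E4-p23 `selfDual_block_package`,
the `hSD` letter of ★ `residual_invariants_finiteDimensional_maximalLevel_cm_final`, paid) models `Sc` by `V = (atoms, line) : L² →ₗ (⊕_{c∈S} W) × L²((0,∞); W)` through ★ p861360's
rank-one self-dual Plancherel isometry, INJECTIVE on `Sc`, with the gauge Hecke operator `T = R_∞(a♮) ∘L R_f(e)` acting on `V_P = Fix(P)`, `P = P_1 ∘L R_f(e)`, through the LINE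
coordinate by the symbol `ŝ(½+i·)` of an entire non-constant `ŝ` (THE RESIDUE-OPERATOR-FORM INTERTWINING `hU`) and `{ŝ(½+i·) = c}` null (`hline`).  ★ D5′ with only the model letters
(`lpModel_blockProj_eq_zero_letterFree_two`) gives, for every topologically irreducible closed `W′ ≤ L²` and `y ∈ W′`: **the line coordinate of `P_{Sc}(P y)` vanishes**, i.e.
`P_{Sc}(P y) ∈ At := Sc ⊓ ker (snd ∘ V)`.  With `P` self-adjoint and fixing `Sc` (wave packets are right-`K`-invariant): for `v ∈ Ln := Sc ⊓ Atᗮ` (★ H4″ `resHLine`),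
`⟪v, y⟫ = ⟪P v, y⟫ = ⟪v, P y⟫ = ⟪v, P_{Sc}(P y)⟫ + ⟪v, P y − P_{Sc}(P y)⟫ = 0 + 0` (★ N-iface `inner_eq_zero_of_mem_resHLine`).  So **`W′ ⟂ resHLine L μ V K 1 χ`** — the SD blocks DO
carry residual atoms (the residues at the real poles), so unlike the off-dual case only the LINE space is avoided; that is exactly (N_blk).
* §1 **`exists_blockModel_subrep_le_orthogonal_resHLine_selfDual_maximalLevel`** — `∃ (A …) (V : L² →ₗ A × L²(Ω; E))`, `V` injective on `Sc`, and `∀ W′` irreducible,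
  `W′.toSubmodule ≤ (resHLine L μ V K 1 χ)ᗮ`; visible ONLY the measures `ν_∞, ν_f, μ_K`, `χ₁ ≡ 1`, `e` (`e* = e`) and the block datum `(χ, hray, hsd, hne)` — letter-light as ★ OD §4.
* §2 **`exists_blockModel_resH_isotypic_le_orthogonal_lines_selfDual_maximalLevel`** — the same package with the `hN` BYTES of ★ p862113 (residual + isotypic hypotheses, idle).
HONEST (census 03:20:22Z, option A): the clause is proved for the RUNG-1 package's own coordinate map `V`; ★ `exists_blockModelFamily_top` (p863444) models the SD blocks by ★ p863337's
`Uiso` — consuming this file there needs either re-pointing the top family's SD model to `V` (also factoring through `P_{Sc}`, injective on `Sc`) or the bridge «`snd ∘ sdModelMap Uiso` and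
`snd ∘ V` have the same kernel on `Sc`» (both are ★ p861360's continuous coordinate) — option B, not in this file.
HONEST LABEL: HC_CM is proved only modulo the 7 printed citations (2 remaining named inputs: hLiu418 = `stmt-HodgeConjecture-24832`, h413 = `stmt-HodgeConjecture-24833`) until
rung 0 closes; REL ≠ ★ ≠ BUILT; this file asserts no named fact, is conditional by construction on its visible structural binders, and closes no socket; count-neutral.

## References
* [MoeglinWaldspurger1995] C. Mœglin, J.-L. Waldspurger, *Spectral Decomposition and Eisenstein Series* (1995), II.2.4, IV.1.10, IV.3.12, V.3.13, VI.2.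
* [ReedSimonI1980] M. Reed, B. Simon, *Methods of Modern Mathematical Physics I* (1980), Thm. II.3, §VII.2.
* [BorelJacquet1979] A. Borel, H. Jacquet, *Automorphic forms and automorphic representations*, PSPM 33.1 (1979), §4.1, §4.6.
* [Knapp1986] A. W. Knapp, *Representation Theory of Semisimple Groups* (1986), VIII §3.
-/

set_option autoImplicit false
set_option linter.dupNamespace false  -- the mandated namespace `…HodgeConjecture.HodgeConjecture.R90.S8` (LEAD #1 L1) repeats the summit's segment

noncomputable section

open MeasureTheory MeasureTheory.Measure Filter Topology CompactlySupported NumberField NumberField.mixedEmbedding NumberField.InfinitePlace IsDedekindDomain Set Complex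
open scoped ENNReal NNReal ComplexConjugate InnerProductSpace
open Literature.NumberTheory Literature.NumberTheory.Automorphic Literature.NumberTheory.Automorphic.UnitaryGroup Literature.NumberTheory.GaloisRepresentations AdelicGroupData ContRepresentation
open Summit.HodgeConjecture.HodgeConjecture.Cruxes.H413.K2E1BorelEisensteinU
open Summit.HodgeConjecture.HodgeConjecture.Cruxes.H413.K2E1CharacterEisensteinU2Defs
open Summit.HodgeConjecture.HodgeConjecture.Cruxes.H413.K2E1ChiSectionSpaceU2Defs
open Summit.HodgeConjecture.HodgeConjecture.Cruxes.H413.K2E1CuspidalSpectrumUnitary (residualSubspace)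
open Summit.HodgeConjecture.HodgeConjecture.Cruxes.H413.K2E1ResidualBlockPackageOffDualM1CMTwo (m1_level_witness)
open Summit.HodgeConjecture.HodgeConjecture.Cruxes.H413.K2E1ResidualBlockPackageSelfDualM1CMTwo (selfDual_block_package)
open Literature.NumberTheory.GaloisRepresentations (HeckeCharacter.isUnitary_of_map_posRealIdele)
open Summit.HodgeConjecture.HodgeConjecture.Cruxes.H413.K2E1ResidualBlockPackageOffDualHeckeCMTwo (rightRegular_apply_brick_eq_self apply_eq_self_of_mem_topologicalClosure_span)
open Summit.HodgeConjecture.HodgeConjecture.Cruxes.H413.K2E1BlockHeckeTBLetterFreeCMTwo (lpModel_blockProj_eq_zero_letterFree_two)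
open Summit.HodgeConjecture.HodgeConjecture.Cruxes.H413.K2E1BlockProjectorFixesVectorsU (cm_blockProjector_hPfix)
open Summit.HodgeConjecture.HodgeConjecture.Cruxes.H413.K2E1HeckeAlgebraLettersCM (cm_blockProjector_hPsa)
open Summit.HodgeConjecture.HodgeConjecture.Cruxes.H413.K2E1ArchTransposeKConjugateU2 (antidiagonal_two_over_map antidiagonal_two_over_mul_self antidiagonal_two_over_map_embedding)
open Summit.HodgeConjecture.HodgeConjecture.Cruxes.H413.K2E1MaximalLevelClosureArchFinCMTwo (mem_unitaryOne_of_coe_mem_Kinf closure_arch_fin_le_maximalLevel)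
open Summit.HodgeConjecture.HodgeConjecture.Cruxes.H413.K2E1ChiSectionContinuousMaximalLevelCMTwo (hVc_maximalLevel_one)
open Summit.HodgeConjecture.HodgeConjecture.Cruxes.H413.K2E1MaximalLevelHeckePureTensorBridgeCMTwo (adelicVal_archToAdelic_inclusion_mem_standardMaximalCompactGL)

namespace Summit.HodgeConjecture.HodgeConjecture.R90.S8

variable (L : Type) [Field L] [NumberField L] [IsCMField L]
  [MeasurableSpace (quasiSplit (↥(maximalRealSubfield L)) L (IsCMField.complexConj L) 2).Adelic] [BorelSpace (quasiSplit (↥(maximalRealSubfield L)) L (IsCMField.complexConj L) 2).Adelic]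
  (μ : Measure (quasiSplit (↥(maximalRealSubfield L)) L (IsCMField.complexConj L) 2).automorphicQuotient) [(quasiSplit (↥(maximalRealSubfield L)) L (IsCMField.complexConj L) 2).IsAutomorphicMeasure μ]
  [MeasurableSpace (UnitaryGroup.arch (↥(maximalRealSubfield L)) L (IsCMField.complexConj L) 2 ((StdForm.antidiagonal 2).over L))] [BorelSpace (UnitaryGroup.arch (↥(maximalRealSubfield L)) L (IsCMField.complexConj L) 2 ((StdForm.antidiagonal 2).over L))]
  [MeasurableSpace (finAdelic (↥(maximalRealSubfield L)) L (IsCMField.complexConj L) 2 ((StdForm.antidiagonal 2).over L))] [BorelSpace (finAdelic (↥(maximalRealSubfield L)) L (IsCMField.complexConj L) 2 ((StdForm.antidiagonal 2).over L))]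
  (νinf : Measure (UnitaryGroup.arch (↥(maximalRealSubfield L)) L (IsCMField.complexConj L) 2 ((StdForm.antidiagonal 2).over L))) [IsHaarMeasure νinf] [νinf.IsInvInvariant] [SFinite νinf]
  (νf : Measure (finAdelic (↥(maximalRealSubfield L)) L (IsCMField.complexConj L) 2 ((StdForm.antidiagonal 2).over L))) [IsFiniteMeasureOnCompacts νf] [νf.IsMulLeftInvariant] [νf.IsInvInvariant] [νf.IsOpenPosMeasure]
  [MeasurableSpace ↥(UnitaryGroup.arch (↥(maximalRealSubfield L)) L (IsCMField.complexConj L) 2 ((StdForm.antidiagonal 2).over L) ⊓ unitaryGroupOfForm (conjMixed (↥(maximalRealSubfield L)) L (IsCMField.complexConj L)) 1)] [BorelSpace ↥(UnitaryGroup.arch (↥(maximalRealSubfield L)) L (IsCMField.complexConj L) 2 ((StdForm.antidiagonal 2).over L) ⊓ unitaryGroupOfForm (conjMixed (↥(maximalRealSubfield L)) L (IsCMField.complexConj L)) 1)]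
  (μK : Measure ↥(UnitaryGroup.arch (↥(maximalRealSubfield L)) L (IsCMField.complexConj L) 2 ((StdForm.antidiagonal 2).over L) ⊓ unitaryGroupOfForm (conjMixed (↥(maximalRealSubfield L)) L (IsCMField.complexConj L)) 1)) [IsProbabilityMeasure μK] [μK.IsMulLeftInvariant] [μK.IsMulRightInvariant] [μK.IsInvInvariant]
  (χ₁ : C_c(↥(UnitaryGroup.arch (↥(maximalRealSubfield L)) L (IsCMField.complexConj L) 2 ((StdForm.antidiagonal 2).over L) ⊓ unitaryGroupOfForm (conjMixed (↥(maximalRealSubfield L)) L (IsCMField.complexConj L)) 1), ℂ)) (e : C_c(finAdelic (↥(maximalRealSubfield L)) L (IsCMField.complexConj L) 2 ((StdForm.antidiagonal 2).over L), ℂ))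
/-! ## §1 M1, SELF-DUAL block: every irreducible closed `W′ ≤ L²` is orthogonal to the LINE SPACE `resHLine L μ V K 1 χ` of the rung-1 model -/

set_option maxHeartbeats 400000 in
include νinf μK in
/-- **THE SELF-DUAL BLOCK OF MAXIMAL LEVEL: EVERY IRREDUCIBLE IS ORTHOGONAL TO ITS LINE SPACE, IN THE RUNG-1 MODEL** (M1: `K_c := K = K_∞·GL₂(𝒪̂_L)`, `U₀ := GL₂(𝒪̂_L)`,
`K′_f :=` its trace, ★ `m1_level_witness`; `ω = 1`, trivial `K_∞`-type `χ₁ ≡ 1`, maximal-level idempotent `e` with `e* = e`).  For a SELF-DUAL ray-trivial Hecke character `χ`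
(`χʷ = χ`, `χ|_{ℝ_{>0}} = 1`, hence unitary ★) with `V(χ, K, 1) ≠ ⊥`: ★ K2E4-p23's RUNG-1 SD package `selfDual_block_package` supplies the block-model coordinate map
`V = WithLp.linearEquiv ∘ U_iso ∘ P_{Sc}` (★ p861360's rank-one self-dual Plancherel isometry; atoms `⊕_{c ∈ S} W` finite-dimensional, line `L²((0,∞); W)`), injective on the block,
TOGETHER WITH the residue-operator-form Hecke intertwining `hU` (spherical gauge operator `T = R_∞(a♮) ∘L R_f(e)` acting on the line coordinate by the symbol `ŝ(½+i·)`) and `hline`;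
★ D5′ letter-free `lpModel_blockProj_eq_zero_letterFree_two` then kills the LINE COORDINATE of `P_{Sc}(P y)` for every `y` in a topologically irreducible closed `W′ ≤ L²`, and the
N-interface ★ `inner_eq_zero_of_mem_resHLine` (with `P` self-adjoint ★ `cm_blockProjector_hPsa` fixing the block ★ `cm_blockProjector_hPfix` ∕ ★ `rightRegular_apply_brick_eq_self`) gives
**`W′ ⟂ resHLine L μ V K 1 χ`** — the self-dual twin of ★ `subrep_le_orthogonal_resHBlock_offDual_maximalLevel` (there the whole block; here its line space, the atoms being residues).
[cite: MoeglinWaldspurger1995, IV.1.10, IV.3.12, V.3.13, VI.2] [cite: ReedSimonI1980, Thm. II.3] [cite: Knapp1986, VIII §3] -/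
theorem exists_blockModel_subrep_le_orthogonal_resHLine_selfDual_maximalLevel [MeasurableMul (finAdelic (↥(maximalRealSubfield L)) L (IsCMField.complexConj L) 2 ((StdForm.antidiagonal 2).over L))] [ENNReal.HolderTriple ∞ 2 2] (hχ1 : ∀ k, χ₁ k = 1)
    (he0 : ∀ x, x ∉ ((glFiniteIntegralLevel 2 L).comap (finAdelic (↥(maximalRealSubfield L)) L (IsCMField.complexConj L) 2 ((StdForm.antidiagonal 2).over L)).subtype : Subgroup (finAdelic (↥(maximalRealSubfield L)) L (IsCMField.complexConj L) 2 ((StdForm.antidiagonal 2).over L))) → e x = 0) (he1 : ∫ x, e x ∂νf = 1)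
    (heK : ∀ k ∈ ((glFiniteIntegralLevel 2 L).comap (finAdelic (↥(maximalRealSubfield L)) L (IsCMField.complexConj L) 2 ((StdForm.antidiagonal 2).over L)).subtype : Subgroup (finAdelic (↥(maximalRealSubfield L)) L (IsCMField.complexConj L) 2 ((StdForm.antidiagonal 2).over L))), ∀ x, e (k * x) = e x) (hestar : ∀ x, mulStar (⇑e) x = e x)
    {χ : HeckeCharacter L} (hray : ∀ r : ℝ≥0ˣ, χ (posRealIdele L r) = 1) (hsd : reflectChar (IsCMField.complexConj L) χ = χ)
    (hne : chiSectionSpace χ ((standardMaximalCompactGL 2 L).comap (adelicVal (↥(maximalRealSubfield L)) L (IsCMField.complexConj L) 2 ((StdForm.antidiagonal 2).over L)) : Subgroup (quasiSplit (↥(maximalRealSubfield L)) L (IsCMField.complexConj L) 2).Adelic) 1 ≠ ⊥) :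
    ∃ (A : Type) (_ : AddCommGroup A) (_ : Module ℂ A) (_ : FiniteDimensional ℂ A) (Ω : Type) (_ : MeasurableSpace Ω) (m : Measure Ω)
      (E : Type) (_ : NormedAddCommGroup E) (_ : NormedSpace ℂ E) (V : (quasiSplit (↥(maximalRealSubfield L)) L (IsCMField.complexConj L) 2).L2 μ →ₗ[ℂ] (A × Lp E 2 m)),
      (∀ y ∈ resHBlock L μ ((standardMaximalCompactGL 2 L).comap (adelicVal (↥(maximalRealSubfield L)) L (IsCMField.complexConj L) 2 ((StdForm.antidiagonal 2).over L)) : Subgroup (quasiSplit (↥(maximalRealSubfield L)) L (IsCMField.complexConj L) 2).Adelic) 1 χ, V y = 0 → y = 0) ∧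
      ∀ W' : ClosedSubrep ((quasiSplit (↥(maximalRealSubfield L)) L (IsCMField.complexConj L) 2).rightRegular μ), W'.toContRep.IsTopIrreducible →
        W'.toSubmodule ≤ (resHLine L μ V ((standardMaximalCompactGL 2 L).comap (adelicVal (↥(maximalRealSubfield L)) L (IsCMField.complexConj L) 2 ((StdForm.antidiagonal 2).over L)) : Subgroup (quasiSplit (↥(maximalRealSubfield L)) L (IsCMField.complexConj L) 2).Adelic) 1 χ)ᗮ := by
  -- the M1 level data (★ `m1_level_witness`), the compact `K` and its Haar model measure
  obtain ⟨hKcK, hKinfKc, hU₀Kc, hK'U₀, hK'o, hU₀o, hU₀c⟩ := m1_level_witness L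
  haveI : CompactSpace ↥((standardMaximalCompactGL 2 L).comap (adelicVal (↥(maximalRealSubfield L)) L (IsCMField.complexConj L) 2 ((StdForm.antidiagonal 2).over L)) : Subgroup (quasiSplit (↥(maximalRealSubfield L)) L (IsCMField.complexConj L) 2).Adelic) := isCompact_iff_compactSpace.1 isCompact_comap_adelicVal_standardMaximalCompactGL
  -- the block projector `P = P_1 ∘L R_f(e)` (a term of this proof, not a binder)
  obtain ⟨P, hPdef⟩ : ∃ P : (quasiSplit (↥(maximalRealSubfield L)) L (IsCMField.complexConj L) 2).L2 μ →L[ℂ] (quasiSplit (↥(maximalRealSubfield L)) L (IsCMField.complexConj L) 2).L2 μ, P = ((((quasiSplit (↥(maximalRealSubfield L)) L (IsCMField.complexConj L) 2).rightRegular μ).restrict ((archToAdelic (↥(maximalRealSubfield L)) L (IsCMField.complexConj L) 2 ((StdForm.antidiagonal 2).over L)).comp (Subgroup.inclusion (inf_le_left : UnitaryGroup.arch (↥(maximalRealSubfield L)) L (IsCMField.complexConj L) 2 ((StdForm.antidiagonal 2).over L) ⊓ unitaryGroupOfForm (conjMixed (↥(maximalRealSubfield L)) L (IsCMField.complexConj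 L)) 1 ≤ UnitaryGroup.arch (↥(maximalRealSubfield L)) L (IsCMField.complexConj L) 2 ((StdForm.antidiagonal 2).over L))))).integratedOperator (((quasiSplit (↥(maximalRealSubfield L)) L (IsCMField.complexConj L) 2).isUnitary_rightRegular μ).restrict _) (((quasiSplit (↥(maximalRealSubfield L)) L (IsCMField.complexConj L) 2).isStronglyContinuous_rightRegular_holds μ).restrict _ ((continuous_archToAdelic (↥(maximalRealSubfield L)) L (IsCMField.complexConj L) 2 ((StdForm.antidiagonal 2).over L)).comp (continuous_induced_rng.2 continuous_subtype_val))) μK χ₁ ∘L (((quasiSplit (↥(maximalRealSubfield L)) L (IsCMField.complexConj L) 2).rightRegular μ).restrict (finAdelicToAdelic (↥(maximalRealSubfield L)) L (IsCMField.complexConj L) 2 ((StdForm.antidiagonal 2).over L))).integratedOperator (((quasiSplit (↥(maximalRealSubfield L)) L (IsCMField.complexConj L) 2).isUnitary_rightRegular μ).restrict _) (((quasiSplit (↥(maximalRealSubfield L)) L (IsCMField.complexConj L) 2).isStronglyContinuous_rightRegular_holds μ).restrict _ (continuous_finAdelicToAdelic (↥(maximalRealSubfield L)) L (IsCMField.complexConj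 L) 2 ((StdForm.antidiagonal 2).over L))) νf e) := ⟨_, rfl⟩
  -- ★ RUNG-1 SD M1: the self-dual per-block package at `gen :=` the wave packets of the block (K2E4-p23)
  obtain ⟨A, iA₁, iA₂, iA₃, Ω, iΩ, m, E, iE₁, iE₂, V, Jb, iJb, h, s, hs, hhl, hhr, hU, hline, hVinj⟩ := selfDual_block_package L μ νinf νf μK χ₁ e hχ1 _ hK'o he0 he1 heK P hPdef (glFiniteIntegralLevel 2 L) hU₀o hU₀c hK'U₀ hU₀Kc
    (haar : Measure ↥((standardMaximalCompactGL 2 L).comap (adelicVal (↥(maximalRealSubfield L)) L (IsCMField.complexConj L) 2 ((StdForm.antidiagonal 2).over L)) : Subgroup (quasiSplit (↥(maximalRealSubfield L)) L (IsCMField.complexConj L) 2).Adelic)) (HeckeCharacter.isUnitary_of_map_posRealIdele hray) hray hsd hne (hVc_maximalLevel_one L _)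
    {v : (quasiSplit (↥(maximalRealSubfield L)) L (IsCMField.complexConj L) 2).L2 μ |
        ∃ (f : ℝ → ℂ) (_ : Continuous f) (_ : HasCompactSupport f) (_ : tsupport f ⊆ Ioi 0)
          (φ : (quasiSplit (↥(maximalRealSubfield L)) L (IsCMField.complexConj L) 2).Adelic → ℂ) (_ : φ ∈ chiSectionSpace χ ((standardMaximalCompactGL 2 L).comap (adelicVal (↥(maximalRealSubfield L)) L (IsCMField.complexConj L) 2 ((StdForm.antidiagonal 2).over L)) : Subgroup (quasiSplit (↥(maximalRealSubfield L)) L (IsCMField.complexConj L) 2).Adelic) ((1 : ↥((standardMaximalCompactGL 2 L).comap (adelicVal (↥(maximalRealSubfield L)) L (IsCMField.complexConj L) 2 ((StdForm.antidiagonal 2).over L)) : Subgroup (quasiSplit (↥(maximalRealSubfield L)) L (IsCMField.complexConj L) 2).Adelic) →* ℂ) : ↥((standardMaximalCompactGL 2 L).comap (adelicVal (↥(maximalRealSubfield L)) L (IsCMField.complexConj L) 2 ((StdForm.antidiagonal 2).over L)) : Subgroup (quasiSplit (↥(maximalRealSubfield L)) L (IsCMField.complexConj L) 2).Adelic) → ℂ))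 (_ : Continuous φ)
          (hv : MemLp ((quasiSplit (↥(maximalRealSubfield L)) L (IsCMField.complexConj L) 2).quotFun (eisensteinSeriesU (fun g => f (borelHeight g) * φ g))) 2 μ), v = hv.toLp _} rfl
  refine ⟨A, iA₁, iA₂, iA₃, Ω, iΩ, m, E, iE₁, iE₂, V, hVinj, ?_⟩
  intro W' hW' y hy
  -- the block IS `closure span` of that set (★ `resHBlock_def`, `rfl`)
  have hSc : resHBlock L μ ((standardMaximalCompactGL 2 L).comap (adelicVal (↥(maximalRealSubfield L)) L (IsCMField.complexConj L) 2 ((StdForm.antidiagonal 2).over L)) : Subgroup (quasiSplit (↥(maximalRealSubfield L)) L (IsCMField.complexConj L) 2).Adelic) 1 χ = (Submodule.span ℂ {v : (quasiSplit (↥(maximalRealSubfield L)) L (IsCMField.complexConj L) 2).L2 μ |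
        ∃ (f : ℝ → ℂ) (_ : Continuous f) (_ : HasCompactSupport f) (_ : tsupport f ⊆ Ioi 0)
          (φ : (quasiSplit (↥(maximalRealSubfield L)) L (IsCMField.complexConj L) 2).Adelic → ℂ) (_ : φ ∈ chiSectionSpace χ ((standardMaximalCompactGL 2 L).comap (adelicVal (↥(maximalRealSubfield L)) L (IsCMField.complexConj L) 2 ((StdForm.antidiagonal 2).over L)) : Subgroup (quasiSplit (↥(maximalRealSubfield L)) L (IsCMField.complexConj L) 2).Adelic) ((1 : ↥((standardMaximalCompactGL 2 L).comap (adelicVal (↥(maximalRealSubfield L)) L (IsCMField.complexConj L) 2 ((StdForm.antidiagonal 2).over L)) : Subgroup (quasiSplit (↥(maximalRealSubfield L)) L (IsCMField.complexConj L) 2).Adelic) →* ℂ) : ↥((standardMaximalCompactGL 2 L).comap (adelicVal (↥(maximalRealSubfield L)) L (IsCMField.complexConj L) 2 ((StdForm.antidiagonal 2).over L)) : Subgroup (quasiSplit (↥(maximalRealSubfield L)) L (IsCMField.complexConj L) 2).Adelic) → ℂ)) (_ : Continuous φ)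
          (hv : MemLp ((quasiSplit (↥(maximalRealSubfield L)) L (IsCMField.complexConj L) 2).quotFun (eisensteinSeriesU (fun g => f (borelHeight g) * φ g))) 2 μ), v = hv.toLp _}).topologicalClosure := rfl
  haveI : CompleteSpace ↥(Submodule.span ℂ {v : (quasiSplit (↥(maximalRealSubfield L)) L (IsCMField.complexConj L) 2).L2 μ |
        ∃ (f : ℝ → ℂ) (_ : Continuous f) (_ : HasCompactSupport f) (_ : tsupport f ⊆ Ioi 0)
          (φ : (quasiSplit (↥(maximalRealSubfield L)) L (IsCMField.complexConj L) 2).Adelic → ℂ) (_ : φ ∈ chiSectionSpace χ ((standardMaximalCompactGL 2 L).comap (adelicVal (↥(maximalRealSubfield L)) L (IsCMField.complexConj L) 2 ((StdForm.antidiagonal 2).over L)) : Subgroup (quasiSplit (↥(maximalRealSubfield L)) L (IsCMField.complexConj L) 2).Adelic) ((1 : ↥((standardMaximalCompactGL 2 L).comap (adelicVal (↥(maximalRealSubfield L)) L (IsCMField.complexConj L) 2 ((StdForm.antidiagonal 2).over L)) : Subgroup (quasiSplit (↥(maximalRealSubfield L)) L (IsCMField.complexConj L) 2).Adelic) →* ℂ)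 : ↥((standardMaximalCompactGL 2 L).comap (adelicVal (↥(maximalRealSubfield L)) L (IsCMField.complexConj L) 2 ((StdForm.antidiagonal 2).over L)) : Subgroup (quasiSplit (↥(maximalRealSubfield L)) L (IsCMField.complexConj L) 2).Adelic) → ℂ)) (_ : Continuous φ)
          (hv : MemLp ((quasiSplit (↥(maximalRealSubfield L)) L (IsCMField.complexConj L) 2).quotFun (eisensteinSeriesU (fun g => f (borelHeight g) * φ g))) 2 μ), v = hv.toLp _}).topologicalClosure := (Submodule.isClosed_topologicalClosure _).completeSpace_coe
  have hχmul : ∀ k l, χ₁ (k * l) = χ₁ k * χ₁ l := fun k l => by rw [hχ1, hχ1, hχ1, one_mul]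
  have hχinv : ∀ k, conj (χ₁ k⁻¹) = χ₁ k := fun k => by rw [hχ1, hχ1, map_one]
  -- ★ D5′ (letter-free, N = 2): the line coordinate of `P y` vanishes
  have hD5 : ((V ∘ₗ (((Submodule.span ℂ {v : (quasiSplit (↥(maximalRealSubfield L)) L (IsCMField.complexConj L) 2).L2 μ |
        ∃ (f : ℝ → ℂ) (_ : Continuous f) (_ : HasCompactSupport f) (_ : tsupport f ⊆ Ioi 0)
          (φ : (quasiSplit (↥(maximalRealSubfield L)) L (IsCMField.complexConj L) 2).Adelic → ℂ) (_ : φ ∈ chiSectionSpace χ ((standardMaximalCompactGL 2 L).comap (adelicVal (↥(maximalRealSubfield L)) L (IsCMField.complexConj L) 2 ((StdForm.antidiagonal 2).over L)) : Subgroup (quasiSplit (↥(maximalRealSubfield L)) L (IsCMField.complexConj L) 2).Adelic) ((1 : ↥((standardMaximalCompactGL 2 L).comap (adelicVal (↥(maximalRealSubfield L)) L (IsCMField.complexConj L) 2 ((StdForm.antidiagonal 2).over L)) : Subgroup (quasiSplit (↥(maximalRealSubfield L)) L (IsCMField.complexConj L) 2).Adelic) →* ℂ) : ↥((standardMaximalCompactGL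 2 L).comap (adelicVal (↥(maximalRealSubfield L)) L (IsCMField.complexConj L) 2 ((StdForm.antidiagonal 2).over L)) : Subgroup (quasiSplit (↥(maximalRealSubfield L)) L (IsCMField.complexConj L) 2).Adelic) → ℂ)) (_ : Continuous φ)
          (hv : MemLp ((quasiSplit (↥(maximalRealSubfield L)) L (IsCMField.complexConj L) 2).quotFun (eisensteinSeriesU (fun g => f (borelHeight g) * φ g))) 2 μ), v = hv.toLp _}).topologicalClosure.starProjection : (quasiSplit (↥(maximalRealSubfield L)) L (IsCMField.complexConj L) 2).L2 μ →L[ℂ] (quasiSplit (↥(maximalRealSubfield L)) L (IsCMField.complexConj L) 2).L2 μ).toLinearMap)) (P y)).2 = 0 :=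
    lpModel_blockProj_eq_zero_letterFree_two ((StdForm.antidiagonal 2).over L) ((quasiSplit (↥(maximalRealSubfield L)) L (IsCMField.complexConj L) 2).rightRegular μ) ((quasiSplit (↥(maximalRealSubfield L)) L (IsCMField.complexConj L) 2).isUnitary_rightRegular μ) ((quasiSplit (↥(maximalRealSubfield L)) L (IsCMField.complexConj L) 2).isStronglyContinuous_rightRegular_holds μ) νinf νf μK χ₁ e
      (antidiagonal_two_over_map (↥(maximalRealSubfield L)) L (IsCMField.complexConj L)) (antidiagonal_two_over_mul_self L) (antidiagonal_two_over_map_embedding L)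
      hχmul (hχ1 1) hχinv _ he0 he1 heK hestar P hPdef W' hW' h hhl hhr
      ((LinearMap.snd ℂ A (Lp E 2 m)).comp (V ∘ₗ (((Submodule.span ℂ {v : (quasiSplit (↥(maximalRealSubfield L)) L (IsCMField.complexConj L) 2).L2 μ |
        ∃ (f : ℝ → ℂ) (_ : Continuous f) (_ : HasCompactSupport f) (_ : tsupport f ⊆ Ioi 0)
          (φ : (quasiSplit (↥(maximalRealSubfield L)) L (IsCMField.complexConj L) 2).Adelic → ℂ) (_ : φ ∈ chiSectionSpace χ ((standardMaximalCompactGL 2 L).comap (adelicVal (↥(maximalRealSubfield L)) L (IsCMField.complexConj L) 2 ((StdForm.antidiagonal 2).over L)) : Subgroup (quasiSplit (↥(maximalRealSubfield L)) L (IsCMField.complexConj L) 2).Adelic) ((1 : ↥((standardMaximalCompactGL 2 L).comap (adelicVal (↥(maximalRealSubfield L)) L (IsCMField.complexConj L) 2 ((StdForm.antidiagonal 2).over L)) : Subgroup (quasiSplit (↥(maximalRealSubfield L)) L (IsCMField.complexConj L) 2).Adelic) →* ℂ) : ↥((standardMaximalCompactGL 2 L).comap (adelicVal (↥(maximalRealSubfield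 L)) L (IsCMField.complexConj L) 2 ((StdForm.antidiagonal 2).over L)) : Subgroup (quasiSplit (↥(maximalRealSubfield L)) L (IsCMField.complexConj L) 2).Adelic) → ℂ)) (_ : Continuous φ)
          (hv : MemLp ((quasiSplit (↥(maximalRealSubfield L)) L (IsCMField.complexConj L) 2).quotFun (eisensteinSeriesU (fun g => f (borelHeight g) * φ g))) 2 μ), v = hv.toLp _}).topologicalClosure.starProjection : (quasiSplit (↥(maximalRealSubfield L)) L (IsCMField.complexConj L) 2).L2 μ →L[ℂ] (quasiSplit (↥(maximalRealSubfield L)) L (IsCMField.complexConj L) 2).L2 μ).toLinearMap))) s hs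
      (fun j v hv => hU j v hv) hline hy
  -- `P` fixes the block: every wave packet is right-`K_c`-invariant, `ι_f(K′_f) ∪ ι_∞(K_∞) ⊆ K_c`
  have hfixR : ∀ g ∈ ((standardMaximalCompactGL 2 L).comap (adelicVal (↥(maximalRealSubfield L)) L (IsCMField.complexConj L) 2 ((StdForm.antidiagonal 2).over L)) : Subgroup (quasiSplit (↥(maximalRealSubfield L)) L (IsCMField.complexConj L) 2).Adelic), ∀ t ∈ (Submodule.span ℂ {v : (quasiSplit (↥(maximalRealSubfield L)) L (IsCMField.complexConj L) 2).L2 μ |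
        ∃ (f : ℝ → ℂ) (_ : Continuous f) (_ : HasCompactSupport f) (_ : tsupport f ⊆ Ioi 0)
          (φ : (quasiSplit (↥(maximalRealSubfield L)) L (IsCMField.complexConj L) 2).Adelic → ℂ) (_ : φ ∈ chiSectionSpace χ ((standardMaximalCompactGL 2 L).comap (adelicVal (↥(maximalRealSubfield L)) L (IsCMField.complexConj L) 2 ((StdForm.antidiagonal 2).over L)) : Subgroup (quasiSplit (↥(maximalRealSubfield L)) L (IsCMField.complexConj L) 2).Adelic) ((1 : ↥((standardMaximalCompactGL 2 L).comap (adelicVal (↥(maximalRealSubfield L)) L (IsCMField.complexConj L) 2 ((StdForm.antidiagonal 2).over L)) : Subgroup (quasiSplit (↥(maximalRealSubfield L)) L (IsCMField.complexConj L) 2).Adelic) →* ℂ) : ↥((standardMaximalCompactGL 2 L).comap (adelicVal (↥(maximalRealSubfield L)) L (IsCMField.complexConj L) 2 ((StdForm.antidiagonal 2).over L)) : Subgroup (quasiSplit (↥(maximalRealSubfield L)) L (IsCMField.complexConj L) 2).Adelic) → ℂ)) (_ : Continuous φ)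
          (hv : MemLp ((quasiSplit (↥(maximalRealSubfield L)) L (IsCMField.complexConj L) 2).quotFun (eisensteinSeriesU (fun g => f (borelHeight g) * φ g))) 2 μ), v = hv.toLp _}).topologicalClosure, ((quasiSplit (↥(maximalRealSubfield L)) L (IsCMField.complexConj L) 2).rightRegular μ) g t = t := fun g hg =>
    apply_eq_self_of_mem_topologicalClosure_span (((quasiSplit (↥(maximalRealSubfield L)) L (IsCMField.complexConj L) 2).rightRegular μ) g : (quasiSplit (↥(maximalRealSubfield L)) L (IsCMField.complexConj L) 2).L2 μ →L[ℂ] (quasiSplit (↥(maximalRealSubfield L)) L (IsCMField.complexConj L) 2).L2 μ) (by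
      rintro t ⟨f, -, -, -, φ, hφ, -, hv, rfl⟩
      exact rightRegular_apply_brick_eq_self L μ hKcK hφ hv hg)
  have hKinfKc' : ∀ k : ↥(UnitaryGroup.arch (↥(maximalRealSubfield L)) L (IsCMField.complexConj L) 2 ((StdForm.antidiagonal 2).over L) ⊓ unitaryGroupOfForm (conjMixed (↥(maximalRealSubfield L)) L (IsCMField.complexConj L)) 1), (archToAdelic (↥(maximalRealSubfield L)) L (IsCMField.complexConj L) 2 ((StdForm.antidiagonal 2).over L)) ((Subgroup.inclusion (inf_le_left : UnitaryGroup.arch (↥(maximalRealSubfield L)) L (IsCMField.complexConj L) 2 ((StdForm.antidiagonal 2).over L) ⊓ unitaryGroupOfForm (conjMixed (↥(maximalRealSubfield L)) L (IsCMField.complexConj L)) 1 ≤ UnitaryGroup.arch (↥(maximalRealSubfield L)) L (IsCMField.complexConj L) 2 ((StdForm.antidiagonal 2).over L))) k) ∈ ((standardMaximalCompactGL 2 L).comap (adelicVal (↥(maximalRealSubfield L)) L (IsCMField.complexConj L) 2 ((StdForm.antidiagonal 2).over L)) : Subgroup (quasiSplit (↥(maximalRealSubfield L)) L (IsCMField.complexConj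 L) 2).Adelic) := fun k =>
    hKinfKc _ (adelicVal_archToAdelic_inclusion_mem_standardMaximalCompactGL k)
  have hPfix : ∀ t ∈ (Submodule.span ℂ {v : (quasiSplit (↥(maximalRealSubfield L)) L (IsCMField.complexConj L) 2).L2 μ |
        ∃ (f : ℝ → ℂ) (_ : Continuous f) (_ : HasCompactSupport f) (_ : tsupport f ⊆ Ioi 0)
          (φ : (quasiSplit (↥(maximalRealSubfield L)) L (IsCMField.complexConj L) 2).Adelic → ℂ) (_ : φ ∈ chiSectionSpace χ ((standardMaximalCompactGL 2 L).comap (adelicVal (↥(maximalRealSubfield L)) L (IsCMField.complexConj L) 2 ((StdForm.antidiagonal 2).over L)) : Subgroup (quasiSplit (↥(maximalRealSubfield L)) L (IsCMField.complexConj L) 2).Adelic) ((1 : ↥((standardMaximalCompactGL 2 L).comap (adelicVal (↥(maximalRealSubfield L)) L (IsCMField.complexConj L) 2 ((StdForm.antidiagonal 2).over L)) : Subgroup (quasiSplit (↥(maximalRealSubfield L)) L (IsCMField.complexConj L) 2).Adelic) →* ℂ) : ↥((standardMaximalCompactGL 2 L).comap (adelicVal (↥(maximalRealSubfield L)) L (IsCMField.complexConj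 L) 2 ((StdForm.antidiagonal 2).over L)) : Subgroup (quasiSplit (↥(maximalRealSubfield L)) L (IsCMField.complexConj L) 2).Adelic) → ℂ)) (_ : Continuous φ)
          (hv : MemLp ((quasiSplit (↥(maximalRealSubfield L)) L (IsCMField.complexConj L) 2).quotFun (eisensteinSeriesU (fun g => f (borelHeight g) * φ g))) 2 μ), v = hv.toLp _}).topologicalClosure, P t = t := by
    intro t ht
    rw [hPdef]
    refine cm_blockProjector_hPfix ((quasiSplit (↥(maximalRealSubfield L)) L (IsCMField.complexConj L) 2).rightRegular μ) ((quasiSplit (↥(maximalRealSubfield L)) L (IsCMField.complexConj L) 2).isUnitary_rightRegular μ) ((quasiSplit (↥(maximalRealSubfield L)) L (IsCMField.complexConj L) 2).isStronglyContinuous_rightRegular_holds μ) νf (Subgroup.inclusion (inf_le_left : UnitaryGroup.arch (↥(maximalRealSubfield L)) L (IsCMField.complexConj L) 2 ((StdForm.antidiagonal 2).over L) ⊓ unitaryGroupOfForm (conjMixed (↥(maximalRealSubfield L)) L (IsCMField.complexConj L)) 1 ≤ UnitaryGroup.arch (↥(maximalRealSubfield L)) L (IsCMField.complexConj L) 2 ((StdForm.antidiagonal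 2).over L))) (continuous_induced_rng.2 continuous_subtype_val) μK χ₁ e hχmul (hχ1 1) _ he0 he1 t (fun u hu => ?_) (fun k => ?_)
    · exact hfixR _ (hU₀Kc u ((hK'U₀ u).1 hu)) t ht
    · rw [hχ1, one_smul]
      exact hfixR _ (hKinfKc' k) t ht
  -- `P` is self-adjoint
  have hPsa : ∀ x z : (quasiSplit (↥(maximalRealSubfield L)) L (IsCMField.complexConj L) 2).L2 μ, ⟪P x, z⟫_ℂ = ⟪x, P z⟫_ℂ := fun x z => by
    rw [hPdef]
    exact cm_blockProjector_hPsa ((quasiSplit (↥(maximalRealSubfield L)) L (IsCMField.complexConj L) 2).rightRegular μ) ((quasiSplit (↥(maximalRealSubfield L)) L (IsCMField.complexConj L) 2).isUnitary_rightRegular μ) ((quasiSplit (↥(maximalRealSubfield L)) L (IsCMField.complexConj L) 2).isStronglyContinuous_rightRegular_holds μ) νf (Subgroup.inclusion (inf_le_left : UnitaryGroup.arch (↥(maximalRealSubfield L)) L (IsCMField.complexConj L) 2 ((StdForm.antidiagonal 2).over L) ⊓ unitaryGroupOfForm (conjMixed (↥(maximalRealSubfield L)) L (IsCMField.complexConj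 L)) 1 ≤ UnitaryGroup.arch (↥(maximalRealSubfield L)) L (IsCMField.complexConj L) 2 ((StdForm.antidiagonal 2).over L))) (continuous_induced_rng.2 continuous_subtype_val) μK χ₁ e hχinv hestar x z
  -- conclude: `⟪v, y⟫ = ⟪P v, y⟫ = ⟪v, P y⟫ = ⟪v, P_{Sc}(P y)⟫ + ⟪v, P y − P_{Sc}(P y)⟫ = 0`
  rw [Submodule.mem_orthogonal]
  intro v hv
  have hvSc : v ∈ (Submodule.span ℂ {v : (quasiSplit (↥(maximalRealSubfield L)) L (IsCMField.complexConj L) 2).L2 μ |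
        ∃ (f : ℝ → ℂ) (_ : Continuous f) (_ : HasCompactSupport f) (_ : tsupport f ⊆ Ioi 0)
          (φ : (quasiSplit (↥(maximalRealSubfield L)) L (IsCMField.complexConj L) 2).Adelic → ℂ) (_ : φ ∈ chiSectionSpace χ ((standardMaximalCompactGL 2 L).comap (adelicVal (↥(maximalRealSubfield L)) L (IsCMField.complexConj L) 2 ((StdForm.antidiagonal 2).over L)) : Subgroup (quasiSplit (↥(maximalRealSubfield L)) L (IsCMField.complexConj L) 2).Adelic) ((1 : ↥((standardMaximalCompactGL 2 L).comap (adelicVal (↥(maximalRealSubfield L)) L (IsCMField.complexConj L) 2 ((StdForm.antidiagonal 2).over L)) : Subgroup (quasiSplit (↥(maximalRealSubfield L)) L (IsCMField.complexConj L) 2).Adelic) →* ℂ) : ↥((standardMaximalCompactGL 2 L).comap (adelicVal (↥(maximalRealSubfield L)) L (IsCMField.complexConj L) 2 ((StdForm.antidiagonal 2).over L)) : Subgroup (quasiSplit (↥(maximalRealSubfield L)) L (IsCMField.complexConj L) 2).Adelic) → ℂ)) (_ : Continuous φ)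
          (hv : MemLp ((quasiSplit (↥(maximalRealSubfield L)) L (IsCMField.complexConj L) 2).quotFun (eisensteinSeriesU (fun g => f (borelHeight g) * φ g))) 2 μ), v = hv.toLp _}).topologicalClosure := resHLine_le_resHBlock L μ V _ 1 χ hv
  calc ⟪v, y⟫_ℂ = ⟪P v, y⟫_ℂ := by rw [hPfix v hvSc]
    _ = ⟪v, P y⟫_ℂ := hPsa v y
    _ = 0 := by
        refine inner_eq_zero_of_mem_resHLine L μ V _ 1 χ hv (P y) ?_
        rw [hSc]
        exact ⟨_, Submodule.starProjection_apply_mem _ (P y), Submodule.sub_starProjection_mem_orthogonal (P y), hD5⟩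


/-! ## §2 The (N_blk) clause BY NAME (★ p862113's `hN` bytes) for the self-dual blocks at the top row, rung-1 model -/

include νinf μK in
/-- **(N_blk) FOR THE SELF-DUAL BLOCKS AT THE TOP ROW `(K_max, 1)`, IN THE RUNG-1 MODEL — `hSD` IN RESIDUE-OPERATOR FORM CONSUMED** — the `hN` bytes of ★ p862113 (:90–92) at
`(K′, ω, Ln) := (K, 1, resHLine L μ V K 1 χ)` for the RUNG-1 SD coordinate map `V` of §1 (∃-bound with its injectivity on the block; the residual and isotypic hypotheses are idle).
HONEST: the clause is delivered for the rung-1 package's OWN coordinate map `V`; for ★ p863337's `Uiso` (the model chosen in ★ `exists_blockModelFamily_top`) a bridge «same line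
kernel on the block» or a re-pointing of the top family to `V` is the consumer's one remaining step. [cite: MoeglinWaldspurger1995, IV.1.10, V.3.13, VI.2] [cite: ReedSimonI1980, Thm. II.3] -/
theorem exists_blockModel_resH_isotypic_le_orthogonal_lines_selfDual_maximalLevel [MeasurableMul (finAdelic (↥(maximalRealSubfield L)) L (IsCMField.complexConj L) 2 ((StdForm.antidiagonal 2).over L))] [ENNReal.HolderTriple ∞ 2 2] (hχ1 : ∀ k, χ₁ k = 1)
    (he0 : ∀ x, x ∉ ((glFiniteIntegralLevel 2 L).comap (finAdelic (↥(maximalRealSubfield L)) L (IsCMField.complexConj L) 2 ((StdForm.antidiagonal 2).over L)).subtype : Subgroup (finAdelic (↥(maximalRealSubfield L)) L (IsCMField.complexConj L) 2 ((StdForm.antidiagonal 2).over L))) → e x = 0) (he1 : ∫ x, e x ∂νf = 1)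
    (heK : ∀ k ∈ ((glFiniteIntegralLevel 2 L).comap (finAdelic (↥(maximalRealSubfield L)) L (IsCMField.complexConj L) 2 ((StdForm.antidiagonal 2).over L)).subtype : Subgroup (finAdelic (↥(maximalRealSubfield L)) L (IsCMField.complexConj L) 2 ((StdForm.antidiagonal 2).over L))), ∀ x, e (k * x) = e x) (hestar : ∀ x, mulStar (⇑e) x = e x)
    {χ : HeckeCharacter L} (hray : ∀ r : ℝ≥0ˣ, χ (posRealIdele L r) = 1) (hsd : reflectChar (IsCMField.complexConj L) χ = χ)
    (hne : chiSectionSpace χ ((standardMaximalCompactGL 2 L).comap (adelicVal (↥(maximalRealSubfield L)) L (IsCMField.complexConj L) 2 ((StdForm.antidiagonal 2).over L)) : Subgroup (quasiSplit (↥(maximalRealSubfield L)) L (IsCMField.complexConj L) 2).Adelic) 1 ≠ ⊥)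
    (𝔓 : (quasiSplit (↥(maximalRealSubfield L)) L (IsCMField.complexConj L) 2).ParabolicUnipotentData) :
    ∃ (A : Type) (_ : AddCommGroup A) (_ : Module ℂ A) (_ : FiniteDimensional ℂ A) (Ω : Type) (_ : MeasurableSpace Ω) (m : Measure Ω)
      (E : Type) (_ : NormedAddCommGroup E) (_ : NormedSpace ℂ E) (V : (quasiSplit (↥(maximalRealSubfield L)) L (IsCMField.complexConj L) 2).L2 μ →ₗ[ℂ] (A × Lp E 2 m)),
      (∀ y ∈ resHBlock L μ ((standardMaximalCompactGL 2 L).comap (adelicVal (↥(maximalRealSubfield L)) L (IsCMField.complexConj L) 2 ((StdForm.antidiagonal 2).over L)) : Subgroup (quasiSplit (↥(maximalRealSubfield L)) L (IsCMField.complexConj L) 2).Adelic) 1 χ, V y = 0 → y = 0) ∧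
      ∀ W' : ClosedSubrep ((quasiSplit (↥(maximalRealSubfield L)) L (IsCMField.complexConj L) 2).rightRegular μ), W'.toContRep.IsTopIrreducible → W' ≤ residualSubspace (quasiSplit (↥(maximalRealSubfield L)) L (IsCMField.complexConj L) 2) μ 𝔓 →
        W'.toSubmodule ⊓ (⨅ k : ↥((standardMaximalCompactGL 2 L).comap (adelicVal (↥(maximalRealSubfield L)) L (IsCMField.complexConj L) 2 ((StdForm.antidiagonal 2).over L)) : Subgroup (quasiSplit (↥(maximalRealSubfield L)) L (IsCMField.complexConj L) 2).Adelic), Module.End.eigenspace ((((quasiSplit (↥(maximalRealSubfield L)) L (IsCMField.complexConj L) 2).rightRegular μ) ((((standardMaximalCompactGL 2 L).comap (adelicVal (↥(maximalRealSubfield L)) L (IsCMField.complexConj L) 2 ((StdForm.antidiagonal 2).over L)) : Subgroup (quasiSplit (↥(maximalRealSubfield L)) L (IsCMField.complexConj L) 2).Adelic)).subtype k) : (quasiSplit (↥(maximalRealSubfield L)) L (IsCMField.complexConj L) 2).L2 μ →L[ℂ] (quasiSplit (↥(maximalRealSubfield L)) L (IsCMField.complexConj L) 2).L2 μ) : (quasiSplit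 (↥(maximalRealSubfield L)) L (IsCMField.complexConj L) 2).L2 μ →ₗ[ℂ] (quasiSplit (↥(maximalRealSubfield L)) L (IsCMField.complexConj L) 2).L2 μ) ((1 : ↥((standardMaximalCompactGL 2 L).comap (adelicVal (↥(maximalRealSubfield L)) L (IsCMField.complexConj L) 2 ((StdForm.antidiagonal 2).over L)) : Subgroup (quasiSplit (↥(maximalRealSubfield L)) L (IsCMField.complexConj L) 2).Adelic) →* ℂ) k)) ≤
          (resHLine L μ V ((standardMaximalCompactGL 2 L).comap (adelicVal (↥(maximalRealSubfield L)) L (IsCMField.complexConj L) 2 ((StdForm.antidiagonal 2).over L)) : Subgroup (quasiSplit (↥(maximalRealSubfield L)) L (IsCMField.complexConj L) 2).Adelic) 1 χ)ᗮ := by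
  obtain ⟨A, iA₁, iA₂, iA₃, Ω, iΩ, m, E, iE₁, iE₂, V, hVinj, hW⟩ :=
    exists_blockModel_subrep_le_orthogonal_resHLine_selfDual_maximalLevel L μ νinf νf μK χ₁ e hχ1 he0 he1 heK hestar hray hsd hne
  exact ⟨A, iA₁, iA₂, iA₃, Ω, iΩ, m, E, iE₁, iE₂, V, hVinj, fun W' hW' _ => inf_le_left.trans (hW W' hW')⟩

end Summit.HodgeConjecture.HodgeConjecture.R90.S8

end
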